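import Mathlib
import HarnessLib
import Summits.ValiantsHypothesis.ValiantsHypothesis.Theorems.MonotoneRestorationOrbitRestorationQPCorePatternsAffine

/-!
# INJ (row side): injective-placement power sums of a local affine form are narrow, treewidth `≤ r + c + 1`

Route MonotoneRestoration, crux `OrbitRestorationQP` (stmt-ValiantsHypothesis-18293), SPAN-currency lane of the open
sub-rung A_∞ (`stub_sigmaPiSigmaValue`); evidence note `SPAN-CURRENCY-A1-g7g4.md` §5 (lemma INJ, plan B).  Helper
(`--supports`), def-free.

* `localForm_comp_eq_merged` — placing a local affine form along `g ∘ π` (`π : Fin r → Fin r'` any map of core rows) is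
  placing the MERGED datum (`ᾱ(i,b) = Σ_{π a = i} α(a,b)`, `β̄ i = Σ_{π a = i} β a`) along `g`;
* `sum_filter_injective_eq_sum_powerset` — inclusion–exclusion: the sum over INJECTIVE row placements is the signed sum,
  over sets `S` of row pairs, of the sums over placements constant on the pairs of `S`;
* `sum_resp_pow_affineLocalForm_mem_narrowSpan` — placements constant on the pairs of `S` are placements of the datum
  merged along the connected components of `([r], S)` (`SimpleGraph.ConnectedComponent.lift`), an instance of the
  engine `CorePatterns.sum_placements_pow_affineLocalForm_mem_narrowSpan` (core `Fin r' × Fin c`, `r' ≤ r`);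
* **`sum_injective_placements_pow_affineLocalForm_mem_narrowSpan`** — INJ on the row side:
  `Σ_{φ : Fin r → [n] injective} Σ_{ψ : Fin c → [n]} (β₀ + δU + ℓ^{φ,ψ})^k ∈ span_ℂ {hom_{F,n} : tw F ≤ r + c + 1}`.
  (The column side is symmetric; both sides together follow by running the same inclusion–exclusion on column pairs with
  this lemma as the base.)

Honest label: infrastructure; no stub closed; VP ≠ VNP untouched.
-/

noncomputable section

-- `Summit.ValiantsHypothesis.ValiantsHypothesis.…` is the tree's single-conjunct layout (Sub = Summit).
set_option linter.dupNamespace false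

namespace Summit.ValiantsHypothesis.ValiantsHypothesis.Theorems

namespace CorePatterns

open MvPolynomial Finset
open Literature.Computability.AlgebraicComplexity (homPoly)
open Literature.Combinatorics.SimpleGraph (treewidth)

/-! ### Merging the core rows along a map -/

/-- **Placing along `g ∘ π` = placing the merged datum along `g`.** [folklore] -/
theorem localForm_comp_eq_merged (n r r' c : ℕ) (β₀ δ : ℂ) (α : Fin r × Fin c → ℂ) (β : Fin r → ℂ) (γ : Fin c → ℂ)
    (π : Fin r → Fin r') (g : Fin r' → Fin n) (ψ : Fin c → Fin n) :
    (C β₀ + C δ * ∑ i : Fin n, ∑ j : Fin n, (X (i, j) : MvPolynomial (Fin n × Fin n) ℂ)) +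
        ((∑ ab : Fin r × Fin c, C (α ab) * (X (g (π ab.1), ψ ab.2) : MvPolynomial (Fin n × Fin n) ℂ)) +
          (∑ a : Fin r, C (β a) * ∑ j : Fin n, (X (g (π a), j) : MvPolynomial (Fin n × Fin n) ℂ)) +
          (∑ b : Fin c, C (γ b) * ∑ j : Fin n, (X (j, ψ b) : MvPolynomial (Fin n × Fin n) ℂ))) =
    (C β₀ + C δ * ∑ i : Fin n, ∑ j : Fin n, (X (i, j) : MvPolynomial (Fin n × Fin n) ℂ)) +
        ((∑ ib : Fin r' × Fin c, C (∑ a ∈ (univ : Finset (Fin r)).filter (fun a => π a = ib.1), α (a, ib.2)) *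
            (X (g ib.1, ψ ib.2) : MvPolynomial (Fin n × Fin n) ℂ)) +
          (∑ i : Fin r', C (∑ a ∈ (univ : Finset (Fin r)).filter (fun a => π a = i), β a) *
            ∑ j : Fin n, (X (g i, j) : MvPolynomial (Fin n × Fin n) ℂ)) +
          (∑ b : Fin c, C (γ b) * ∑ j : Fin n, (X (j, ψ b) : MvPolynomial (Fin n × Fin n) ℂ))) := by
  congr 2
  · congr 1
    · -- cells
      rw [Fintype.sum_prod_type, Fintype.sum_prod_type]
      symm
      rw [Finset.sum_comm]
      conv_rhs => rw [Finset.sum_comm]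
      refine Finset.sum_congr rfl fun b _ => ?_
      simp_rw [map_sum, Finset.sum_mul]
      rw [← Finset.sum_fiberwise (univ : Finset (Fin r)) π
        (fun a => C (α (a, b)) * (X (g (π a), ψ b) : MvPolynomial (Fin n × Fin n) ℂ))]
      refine Finset.sum_congr rfl fun i _ => Finset.sum_congr rfl fun a ha => ?_
      rw [(Finset.mem_filter.1 ha).2]
    · -- row pendants
      symm
      simp_rw [map_sum, Finset.sum_mul]
      rw [← Finset.sum_fiberwise (univ : Finset (Fin r)) π
        (fun a => C (β a) * ∑ j : Fin n, (X (g (π a), j) : MvPolynomial (Fin n × Fin n) ℂ))]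
      refine Finset.sum_congr rfl fun i _ => Finset.sum_congr rfl fun a ha => ?_
      rw [(Finset.mem_filter.1 ha).2]

/-! ### Inclusion–exclusion over row pairs -/

/-- **Inclusion–exclusion for injectivity**: the sum over injective maps `Fin r → Fin n` equals the signed sum, over
sets `S` of pairs `a < a'`, of the sums over maps constant on every pair of `S`. [folklore] -/
theorem sum_filter_injective_eq_sum_powerset {M : Type*} [AddCommGroup M] (r n : ℕ) (W : (Fin r → Fin n) → M) :
    (∑ φ ∈ (univ : Finset (Fin r → Fin n)).filter (fun φ => Function.Injective φ), W φ) =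
      ∑ S ∈ ((univ : Finset (Fin r × Fin r)).filter (fun p => p.1 < p.2)).powerset,
        ((-1 : ℤ) ^ S.card) • ∑ φ ∈ (univ : Finset (Fin r → Fin n)).filter (fun φ => ∀ p ∈ S, φ p.1 = φ p.2), W φ := by
  classical
  -- per placement: the signed count of the pair sets it respects
  have key : ∀ φ : Fin r → Fin n,
      (∑ S ∈ ((univ : Finset (Fin r × Fin r)).filter (fun p => p.1 < p.2)).powerset,
        if (∀ p ∈ S, φ p.1 = φ p.2) then ((-1 : ℤ) ^ S.card) else 0) =
      if Function.Injective φ then 1 else 0 := by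
    intro φ
    rw [← Finset.sum_filter]
    have hset : (((univ : Finset (Fin r × Fin r)).filter (fun p => p.1 < p.2)).powerset.filter
        (fun S => ∀ p ∈ S, φ p.1 = φ p.2)) =
        (((univ : Finset (Fin r × Fin r)).filter (fun p => p.1 < p.2)).filter
          (fun p => φ p.1 = φ p.2)).powerset := by
      ext S
      simp only [Finset.mem_filter, Finset.mem_powerset, Finset.subset_iff, Finset.mem_univ, true_and]
      constructor
      · rintro ⟨h1, h2⟩ p hp
        exact ⟨h1 hp, h2 p hp⟩
      · intro h
        exact ⟨fun p hp => (h hp).1, fun p hp => (h hp).2⟩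
    rw [hset, Finset.sum_powerset_neg_one_pow_card]
    congr 1
    simp only [Finset.filter_eq_empty_iff, Finset.mem_filter, Finset.mem_univ, true_and, eq_iff_iff]
    constructor
    · intro h a a' haa'
      rcases lt_trichotomy a a' with hlt | heq | hgt
      · exact absurd haa' (@h (a, a') hlt)
      · exact heq
      · exact absurd haa'.symm (@h (a', a) hgt)
    · intro hinj p hp heq
      exact absurd (hinj heq) (ne_of_lt hp)
  -- rearrange
  symm
  calc ∑ S ∈ ((univ : Finset (Fin r × Fin r)).filter (fun p => p.1 < p.2)).powerset,
        ((-1 : ℤ) ^ S.card) • ∑ φ ∈ (univ : Finset (Fin r → Fin n)).filter (fun φ => ∀ p ∈ S, φ p.1 = φ p.2), W φ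
      = ∑ S ∈ ((univ : Finset (Fin r × Fin r)).filter (fun p => p.1 < p.2)).powerset,
          ∑ φ : Fin r → Fin n, (if (∀ p ∈ S, φ p.1 = φ p.2) then ((-1 : ℤ) ^ S.card) else 0) • W φ := by
        refine Finset.sum_congr rfl fun S _ => ?_
        rw [Finset.sum_filter, Finset.smul_sum]
        refine Finset.sum_congr rfl fun φ _ => ?_
        split_ifs <;> simp
    _ = ∑ φ : Fin r → Fin n, (∑ S ∈ ((univ : Finset (Fin r × Fin r)).filter (fun p => p.1 < p.2)).powerset,
          (if (∀ p ∈ S, φ p.1 = φ p.2) then ((-1 : ℤ) ^ S.card) else 0)) • W φ := by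
        rw [Finset.sum_comm]
        refine Finset.sum_congr rfl fun φ _ => ?_
        rw [Finset.sum_smul]
    _ = ∑ φ : Fin r → Fin n, (if Function.Injective φ then (1 : ℤ) else 0) • W φ := by
        refine Finset.sum_congr rfl fun φ _ => ?_
        rw [key]
    _ = ∑ φ ∈ (univ : Finset (Fin r → Fin n)).filter (fun φ => Function.Injective φ), W φ := by
        rw [Finset.sum_filter]
        refine Finset.sum_congr rfl fun φ _ => ?_
        split_ifs <;> simp

/-! ### Placements constant on the pairs of `S`: merge along connected components -/

/-- **Placements respecting a set of row pairs are narrow**: the sum over the placements `φ` with `φ a = φ a'` for all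
`(a, a') ∈ S` of `Σ_ψ (β₀ + δU + ℓ^{φ,ψ})^k` lies in `span_ℂ {hom_{F,n} : tw F ≤ r + c + 1}`. [folklore] -/
theorem sum_resp_pow_affineLocalForm_mem_narrowSpan (n r c k : ℕ) (β₀ δ : ℂ) (α : Fin r × Fin c → ℂ)
    (β : Fin r → ℂ) (γ : Fin c → ℂ) (S : Finset (Fin r × Fin r)) (hS : ∀ p ∈ S, p.1 ≠ p.2) :
    (∑ φ ∈ (univ : Finset (Fin r → Fin n)).filter (fun φ => ∀ p ∈ S, φ p.1 = φ p.2), ∑ ψ : Fin c → Fin n,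
      ((C β₀ + C δ * ∑ i : Fin n, ∑ j : Fin n, (X (i, j) : MvPolynomial (Fin n × Fin n) ℂ)) +
        ((∑ ab : Fin r × Fin c, C (α ab) * (X (φ ab.1, ψ ab.2) : MvPolynomial (Fin n × Fin n) ℂ)) +
          (∑ a : Fin r, C (β a) * ∑ j : Fin n, (X (φ a, j) : MvPolynomial (Fin n × Fin n) ℂ)) +
          (∑ b : Fin c, C (γ b) * ∑ j : Fin n, (X (j, ψ b) : MvPolynomial (Fin n × Fin n) ℂ)))) ^ k) ∈
    Submodule.span ℂ {p : MvPolynomial (Fin n × Fin n) ℂ |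
        ∃ (a b : ℕ) (E : Multiset (Fin a × Fin b)),
          treewidth (SimpleGraph.fromRel fun u v : Fin a ⊕ Fin b =>
            ∃ e ∈ E, u = Sum.inl e.1 ∧ v = Sum.inr e.2) ≤ r + c + 1 ∧ p = homPoly E n ℂ} := by
  classical
  -- the graph of the constraints and its components
  set G : SimpleGraph (Fin r) := SimpleGraph.fromRel fun a a' => (a, a') ∈ S with hGdef
  set r' : ℕ := Fintype.card G.ConnectedComponent with hr'
  set e : G.ConnectedComponent ≃ Fin r' := Fintype.equivFin G.ConnectedComponent with he
  set π : Fin r → Fin r' := fun a => e (G.connectedComponentMk a) with hπ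
  have hπsurj : Function.Surjective π := by
    intro i
    obtain ⟨a, ha⟩ := Quot.exists_rep (e.symm i)
    refine ⟨a, ?_⟩
    simp only [hπ]
    rw [show G.connectedComponentMk a = e.symm i from ha, Equiv.apply_symm_apply]
  have hr'le : r' ≤ r := by
    have := Fintype.card_le_of_surjective π hπsurj
    simpa using this
  -- a placement respecting `S` is constant on components
  have hconst : ∀ φ : Fin r → Fin n, (∀ p ∈ S, φ p.1 = φ p.2) →
      ∀ v w : Fin r, G.Reachable v w → φ v = φ w := by
    intro φ hφ v w hvw
    rw [SimpleGraph.reachable_iff_reflTransGen] at hvw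
    induction hvw with
    | refl => rfl
    | tail _ hadj ih =>
      rw [ih]
      rw [hGdef, SimpleGraph.fromRel_adj] at hadj
      rcases hadj.2 with h | h
      · exact hφ _ h
      · exact (hφ _ h).symm
  -- the respecting placements are exactly the `g ∘ π`
  have himage : (univ : Finset (Fin r → Fin n)).filter (fun φ => ∀ p ∈ S, φ p.1 = φ p.2) =
      (univ : Finset (Fin r' → Fin n)).image (fun g => g ∘ π) := by
    ext φ
    simp only [Finset.mem_filter, Finset.mem_univ, true_and, Finset.mem_image]
    constructor
    · intro hφ
      refine ⟨(SimpleGraph.ConnectedComponent.lift φ fun v w p _ => hconst φ hφ v w p.reachable) ∘ e.symm, ?_⟩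
      funext a
      simp [hπ]
    · rintro ⟨g, rfl⟩ p hp
      simp only [Function.comp_apply, hπ]
      rw [SimpleGraph.ConnectedComponent.connectedComponentMk_eq_of_adj]
      rw [hGdef, SimpleGraph.fromRel_adj]
      exact ⟨hS p hp, Or.inl (by simpa using hp)⟩
  have hinj : Set.InjOn (fun g : Fin r' → Fin n => g ∘ π) ↑(univ : Finset (Fin r' → Fin n)) :=
    fun g _ g' _ h => hπsurj.injective_comp_right h
  rw [himage, Finset.sum_image hinj]
  -- merge the datum along `π` and apply the engine on the core `Fin r' × Fin c`
  simp_rw [Function.comp_apply]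
  have hmerge := fun (g : Fin r' → Fin n) (ψ : Fin c → Fin n) =>
    localForm_comp_eq_merged n r r' c β₀ δ α β γ π g ψ
  simp_rw [hmerge]
  have hmono : Submodule.span ℂ {p : MvPolynomial (Fin n × Fin n) ℂ |
        ∃ (a b : ℕ) (E : Multiset (Fin a × Fin b)),
          treewidth (SimpleGraph.fromRel fun u v : Fin a ⊕ Fin b =>
            ∃ e ∈ E, u = Sum.inl e.1 ∧ v = Sum.inr e.2) ≤ r' + c + 1 ∧ p = homPoly E n ℂ} ≤
      Submodule.span ℂ {p : MvPolynomial (Fin n × Fin n) ℂ |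
        ∃ (a b : ℕ) (E : Multiset (Fin a × Fin b)),
          treewidth (SimpleGraph.fromRel fun u v : Fin a ⊕ Fin b =>
            ∃ e ∈ E, u = Sum.inl e.1 ∧ v = Sum.inr e.2) ≤ r + c + 1 ∧ p = homPoly E n ℂ} := by
    refine Submodule.span_mono ?_
    rintro p ⟨a, b, E, hE, rfl⟩
    exact ⟨a, b, E, hE.trans (by omega), rfl⟩
  exact hmono (sum_placements_pow_affineLocalForm_mem_narrowSpan n r' c k β₀ δ _ _ γ)

/-- **INJ (row side).**  The sum over INJECTIVE row placements (all column placements) of the `k`-th powers of a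
local affine form lies in `span_ℂ {hom_{F,n} : tw F ≤ r + c + 1}`. [folklore; cite: DwivediPagoSeppelt2026, §8] -/
theorem sum_injective_placements_pow_affineLocalForm_mem_narrowSpan (n r c k : ℕ) (β₀ δ : ℂ)
    (α : Fin r × Fin c → ℂ) (β : Fin r → ℂ) (γ : Fin c → ℂ) :
    (∑ φ ∈ (univ : Finset (Fin r → Fin n)).filter (fun φ => Function.Injective φ), ∑ ψ : Fin c → Fin n,
      ((C β₀ + C δ * ∑ i : Fin n, ∑ j : Fin n, (X (i, j) : MvPolynomial (Fin n × Fin n) ℂ)) +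
        ((∑ ab : Fin r × Fin c, C (α ab) * (X (φ ab.1, ψ ab.2) : MvPolynomial (Fin n × Fin n) ℂ)) +
          (∑ a : Fin r, C (β a) * ∑ j : Fin n, (X (φ a, j) : MvPolynomial (Fin n × Fin n) ℂ)) +
          (∑ b : Fin c, C (γ b) * ∑ j : Fin n, (X (j, ψ b) : MvPolynomial (Fin n × Fin n) ℂ)))) ^ k) ∈
    Submodule.span ℂ {p : MvPolynomial (Fin n × Fin n) ℂ |
        ∃ (a b : ℕ) (E : Multiset (Fin a × Fin b)),
          treewidth (SimpleGraph.fromRel fun u v : Fin a ⊕ Fin b =>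
            ∃ e ∈ E, u = Sum.inl e.1 ∧ v = Sum.inr e.2) ≤ r + c + 1 ∧ p = homPoly E n ℂ} := by
  rw [sum_filter_injective_eq_sum_powerset]
  refine Submodule.sum_mem _ fun S hS => ?_
  refine zsmul_mem ?_ _
  refine sum_resp_pow_affineLocalForm_mem_narrowSpan n r c k β₀ δ α β γ S fun p hp => ?_
  exact ne_of_lt (Finset.mem_filter.1 (Finset.mem_powerset.1 hS hp)).2

end CorePatterns

end Summit.ValiantsHypothesis.ValiantsHypothesis.Theorems

end
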